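/-
Copyright (c) 2026 the pub-hodgecm-mathlib formalisation cell (harness21).  Prover seat hodgecm-mathlib-F0P2-p10 (g2), Track B «K2-LIT»,
#184♮ = hLiu418 = `stmt-HodgeConjecture-24832`; socket #41, KIND 1, organ (K1b-W), seam (KW1-e) PART 2 = (e2): THE PLACE COMPONENTS OF KUDLA'S SEE-SAW CHART `blkD`.
THEOREMS ONLY (no `def`, no `instance`, no notation, no named-fact hypothesis, no `sorry`).
-/
import Literature.NumberTheory.GelbartRogawski1991.DoubledBlockDiagEmbedding   -- ★ `blkD`, `coe_coe_blkD_apply`, `idxSplitD`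
import HarnessLib

/-!
# Crux `HLiu418`, socket #41, KIND 1 ∕ (K1b-W), seam (KW1-e) PART 2 — `K2LiuBlockDiagPlaces`: THE ARCHIMEDEAN AND PLACE-`v` COMPONENTS OF `blkD (h₁, h₂)`
# ARE THE SAME BLOCK-DIAGONAL PATTERN OF THE COMPONENTS — `(blkD (h₁,h₂))_∞ = σ⁻¹[diag((h₁)_∞, (h₂)_∞)]`, `(blkD (h₁,h₂))_v = σ⁻¹[diag((h₁)_v, (h₂)_v)]`

Cell `hodgecm-mathlib`, crux item hLiu418 = `stmt-HodgeConjecture-24832` (route of record `HCCMUnconditional`); squad K2 ∕ K2Liu, road `K2_Liu`, socket #41, KIND 1, the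
K1-b♮ line term; (K1b-W) line lead K2Liu-p14 (g4), K1 desk F0P2-p11 (g2); LEAD F0P6-plan (g14) BATCH #85 (2) ∕ #87 («F0P2-p10 → (KW1-e)»).  My (KW1-e) census
(K2 bus 2026-09-04T22:35:37Z) cut the seam into (e1) structure (★ PART 1 `K2LiuKindOneLineWhittakerTranslate`), **(e2) the place components of `blkD (1, ·)`** (THIS FILE)
and (e3) factorizability transport.  THEOREMS ONLY; lane `--supports stmt-HodgeConjecture-24832 --as helper` (count-neutral).

THE POINT.  ★ #31s `IsFactorizableOff T χ f fT` reads a global section through `archPart`, `finPart` and `evalPlace v` (★ `UnitaryGroupAdelicProduct`,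
★ `UnitaryGroupRestrictedProduct`); to transport factorizability of `f` to the pulled-back family `x ↦ f (blkD (1, x) · g)` of ★ (T4-α) pt 1 (F0P2-p11, p862495) one must
read `blkD` place by place.  Kudla's see-saw chart ★ `GRConstruction.blkD (h₁, h₂) = σ⁻¹-reindex of diag(h₁, h₂)` (`σ = idxSplitD eV eA eB`, ★ `coe_coe_blkD_apply`) is an
ENTRY PERMUTATION of a block-diagonal matrix, and the component maps are ENTRYWISE ring homomorphisms (`g_∞`: ★ `GLn.toMixed` = `InfiniteAdeleRing.ringEquiv_mixedSpace`
entrywise on the archimedean coordinate; `(g_v)_w`: ★ `GLn.evalAt` = evaluation of the finite-adele coordinate at `w`), so they COMMUTE with the chart: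
* §1 **`coe_archPart_blkD_apply`** ∕ **`coe_archPart_blkD`** — `((blkD (h₁,h₂))_∞)_{ij} = diag((h₁)_∞, (h₂)_∞)_{σ i, σ j}`, i.e.
  `↑(blkD (h₁,h₂))_∞ = reindexGL σ⁻¹ (blockDiagGL (↑(h₁)_∞, ↑(h₂)_∞))` in `GL_{n+n}(L ⊗ ℝ)`;
* §2 **`coe_evalPlace_finPart_blkD_apply`** ∕ **`coe_evalPlace_finPart_blkD`** — for every finite place `v` of `L⁺` and `w ∣ v`:
  `(((blkD (h₁,h₂))_v)_w)_{ij} = diag(((h₁)_v)_w, ((h₂)_v)_w)_{σ i, σ j}`, i.e. `((blkD (h₁,h₂))_v)_w = reindexGL σ⁻¹ (blockDiagGL (((h₁)_v)_w, ((h₂)_v)_w))`;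
* §3 the corner specialisations `blkD (1, y)` and `blkD (x, 1)` (`(1)_∞ = 1`, `(1)_v = 1`): the components of the translated corner family's chart are the local corner charts
  of the components — the input of (e3) (`Λ_{s,v}` of ★ `LambdaLoc` evaluated on `((blkD (1,y))_v)·k_v`).
Generic ranks as in ★ `DoubledBlockDiagEmbedding` (`V = V₁ ⊕ V₂`, `dV = dA ‖ dB`, enumerations `eV eA eB`; K1 instance `N₁ = N₂ = M = 1`).
[BorelJacquet1979, §4.1 (`G(𝔸) = G_∞ × G(𝔸_f)`, local components)], [Kudla1984, §1], [Kudla1994, §2], [PlatonovRapinchuk1994, §5.1].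
HONEST LABEL.  Count-neutral helper, closes no socket: `HC_CM` is proved only modulo the 7 printed citations (2 remaining named inputs: hLiu418 =
`stmt-HodgeConjecture-24832`, h413 = `stmt-HodgeConjecture-24833`) until rung 0 closes.

## References
* [BorelJacquet1979] A. Borel, H. Jacquet, *Automorphic forms and automorphic representations*, Proc. Symp. Pure Math. 33.1 (1979), §4.1.
* [Kudla1984] S. Kudla, *Seesaw dual reductive pairs*, Progr. Math. 46 (1984), §1.
* [Kudla1994] S. Kudla, *Splitting metaplectic covers of dual reductive pairs*, Israel J. Math. 87 (1994), §2.
* [PlatonovRapinchuk1994] V. Platonov, A. Rapinchuk, *Algebraic Groups and Number Theory* (1994), §5.1 (local components of adelic points).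
-/

set_option autoImplicit false
set_option linter.dupNamespace false -- the mandated namespace repeats `HodgeConjecture.HodgeConjecture`

noncomputable section

open scoped Classical
open scoped Matrix
open NumberField IsDedekindDomain
open Literature.NumberTheory.Automorphic Literature.NumberTheory.GaloisRepresentations
open Literature.NumberTheory.GelbartRogawski1991 Literature.NumberTheory.GelbartRogawski1991.GRConstruction
open Literature.NumberTheory.GelbartRogawski1991.UnitaryDualPair

namespace Summit.HodgeConjecture.HodgeConjecture.Cruxes.HLiu418.K2LiuBlockDiagPlaces

variable (L : Type) [Field L] [NumberField L] [IsCMField L]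
variable {N₁ N₂ M n n₁ n₂ : ℕ} (eV : Fin (N₁ + N₂) × Fin M ≃ Fin n) (eA : Fin N₁ × Fin M ≃ Fin n₁) (eB : Fin N₂ × Fin M ≃ Fin n₂)
  (dA : Fin N₁ → L) (hdA : ∀ i, IsCMField.complexConj L (dA i) = dA i)
  (dB : Fin N₂ → L) (hdB : ∀ i, IsCMField.complexConj L (dB i) = dB i)
  (dV : Fin (N₁ + N₂) → L) (hdV : ∀ i, IsCMField.complexConj L (dV i) = dV i)
  (hVA : ∀ i, dV (Fin.castAdd N₂ i) = dA i) (hVB : ∀ j, dV (Fin.natAdd N₁ j) = dB j)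
  (dW : Fin M → L) (hdW : ∀ i, IsCMField.complexConj L (dW i) = dW i)

/-! ## §1 The archimedean component of `blkD (h₁, h₂)` -/

/-- **`((blkD (h₁,h₂))_∞)_{ij} = diag((h₁)_∞, (h₂)_∞)_{σ i, σ j}`**: the archimedean component map is entrywise (`InfiniteAdeleRing.ringEquiv_mixedSpace` on the
archimedean coordinate of each entry), the chart an entry permutation of `diag(h₁, h₂)` (★ `coe_coe_blkD_apply`). [cite: BorelJacquet1979, §4.1] [cite: Kudla1994, §2] -/
theorem coe_archPart_blkD_apply (h : HA L eA dA hdA dW hdW × HA L eB dB hdB dW hdW) (i j : Fin (n + n)) :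
    (((UnitaryGroup.archPart (Fp L) L (IsCMField.complexConj L) (n + n) (hermD L eV dV hdV dW hdW)
          (blkD L eV eA eB dA hdA dB hdB dV hdV hVA hVB dW hdW h) :
        UnitaryGroup.arch (Fp L) L (IsCMField.complexConj L) (n + n) (hermD L eV dV hdV dW hdW)) :
        GL (Fin (n + n)) (mixedEmbedding.mixedSpace L)) : Matrix (Fin (n + n)) (Fin (n + n)) (mixedEmbedding.mixedSpace L)) i j =
      Matrix.fromBlocks
        (((UnitaryGroup.archPart (Fp L) L (IsCMField.complexConj L) (n₁ + n₁) (hermD L eA dA hdA dW hdW) h.1 :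
            UnitaryGroup.arch (Fp L) L (IsCMField.complexConj L) (n₁ + n₁) (hermD L eA dA hdA dW hdW)) :
            GL (Fin (n₁ + n₁)) (mixedEmbedding.mixedSpace L)) : Matrix (Fin (n₁ + n₁)) (Fin (n₁ + n₁)) (mixedEmbedding.mixedSpace L))
        0 0
        (((UnitaryGroup.archPart (Fp L) L (IsCMField.complexConj L) (n₂ + n₂) (hermD L eB dB hdB dW hdW) h.2 :
            UnitaryGroup.arch (Fp L) L (IsCMField.complexConj L) (n₂ + n₂) (hermD L eB dB hdB dW hdW)) :
            GL (Fin (n₂ + n₂)) (mixedEmbedding.mixedSpace L)) : Matrix (Fin (n₂ + n₂)) (Fin (n₂ + n₂)) (mixedEmbedding.mixedSpace L))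
        (idxSplitD eV eA eB i) (idxSplitD eV eA eB j) := by
  -- the entry of `g_∞` is the archimedean coordinate of the entry of `g` read in the mixed space (definitional, ★ `GLn.toMixed`)
  have key : ∀ {k : ℕ} {J : Matrix (Fin k) (Fin k) L} (g : ↥(UnitaryGroup.adelic (Fp L) L (IsCMField.complexConj L) k J)) (a b : Fin k),
      (((UnitaryGroup.archPart (Fp L) L (IsCMField.complexConj L) k J g : UnitaryGroup.arch (Fp L) L (IsCMField.complexConj L) k J) :
          GL (Fin k) (mixedEmbedding.mixedSpace L)) : Matrix (Fin k) (Fin k) (mixedEmbedding.mixedSpace L)) a b =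
        InfiniteAdeleRing.ringEquiv_mixedSpace L ((((g : GL (Fin k) (AdeleRing (𝓞 L) L)) : Matrix (Fin k) (Fin k) (AdeleRing (𝓞 L) L)) a b).1) :=
    fun _ _ _ => rfl
  rw [key, coe_coe_blkD_apply]
  generalize idxSplitD eV eA eB i = z
  generalize idxSplitD eV eA eB j = z'
  rcases z with a | a <;> rcases z' with b | b
  · rw [Matrix.fromBlocks_apply₁₁, Matrix.fromBlocks_apply₁₁, key]
  · rw [Matrix.fromBlocks_apply₁₂, Matrix.fromBlocks_apply₁₂, Matrix.zero_apply, Matrix.zero_apply]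
    exact map_zero _
  · rw [Matrix.fromBlocks_apply₂₁, Matrix.fromBlocks_apply₂₁, Matrix.zero_apply, Matrix.zero_apply]
    exact map_zero _
  · rw [Matrix.fromBlocks_apply₂₂, Matrix.fromBlocks_apply₂₂, key]

/-- **`↑(blkD (h₁,h₂))_∞ = reindexGL σ⁻¹ (blockDiagGL (↑(h₁)_∞, ↑(h₂)_∞))`** in `GL_{n+n}(L ⊗_ℚ ℝ)` — the archimedean component of Kudla's see-saw chart is the see-saw chart
of the archimedean components. [cite: BorelJacquet1979, §4.1] [cite: Kudla1984, §1] [cite: Kudla1994, §2] -/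
theorem coe_archPart_blkD (h : HA L eA dA hdA dW hdW × HA L eB dB hdB dW hdW) :
    ((UnitaryGroup.archPart (Fp L) L (IsCMField.complexConj L) (n + n) (hermD L eV dV hdV dW hdW)
          (blkD L eV eA eB dA hdA dB hdB dV hdV hVA hVB dW hdW h) :
        UnitaryGroup.arch (Fp L) L (IsCMField.complexConj L) (n + n) (hermD L eV dV hdV dW hdW)) :
        GL (Fin (n + n)) (mixedEmbedding.mixedSpace L)) =
      UnitaryGroup.reindexGL (idxSplitD eV eA eB).symm
        (UnitaryGroup.blockDiagGL
          (((UnitaryGroup.archPart (Fp L) L (IsCMField.complexConj L) (n₁ + n₁) (hermD L eA dA hdA dW hdW) h.1 :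
              UnitaryGroup.arch (Fp L) L (IsCMField.complexConj L) (n₁ + n₁) (hermD L eA dA hdA dW hdW)) :
              GL (Fin (n₁ + n₁)) (mixedEmbedding.mixedSpace L)),
            ((UnitaryGroup.archPart (Fp L) L (IsCMField.complexConj L) (n₂ + n₂) (hermD L eB dB hdB dW hdW) h.2 :
              UnitaryGroup.arch (Fp L) L (IsCMField.complexConj L) (n₂ + n₂) (hermD L eB dB hdB dW hdW)) :
              GL (Fin (n₂ + n₂)) (mixedEmbedding.mixedSpace L)))) := by
  refine Units.ext (Matrix.ext fun i j => ?_)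
  rw [coe_archPart_blkD_apply, UnitaryGroup.coe_reindexGL, UnitaryGroup.coe_blockDiagGL, Matrix.reindex_apply, Matrix.submatrix_apply,
    Equiv.symm_symm]

/-! ## §2 The place-`v` components of `blkD (h₁, h₂)` -/

/-- **`(((blkD (h₁,h₂))_v)_w)_{ij} = diag(((h₁)_v)_w, ((h₂)_v)_w)_{σ i, σ j}`** for every finite place `v` of `L⁺` and `w ∣ v`: the `w`-block of the `v`-component is the
`w`-evaluation of the finite-adele coordinate of each entry (★ `coe_evalPlace_apply`, ★ `GLn.coe_evalAt_apply`), the chart an entry permutation of `diag(h₁,h₂)`.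
[cite: BorelJacquet1979, §4.1] [cite: PlatonovRapinchuk1994, §5.1] [cite: Kudla1994, §2] -/
theorem coe_evalPlace_finPart_blkD_apply (h : HA L eA dA hdA dW hdW × HA L eB dB hdB dW hdW) (v : HeightOneSpectrum (𝓞 (Fp L)))
    (w : UnitaryGroup.PlacesOver L v) (i j : Fin (n + n)) :
    (((((UnitaryGroup.evalPlace (Fp L) L (IsCMField.complexConj L) (n + n) (hermD L eV dV hdV dW hdW) v
          (UnitaryGroup.finPart (Fp L) L (IsCMField.complexConj L) (n + n) (hermD L eV dV hdV dW hdW) (blkD L eV eA eB dA hdA dB hdB dV hdV hVA hVB dW hdW h)) :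
        UnitaryGroup.localPi L (IsCMField.complexConj L) (n + n) (hermD L eV dV hdV dW hdW) v) : UnitaryGroup.LocalGLPi L (n + n) v) w) : GL (Fin (n + n)) (w.1.adicCompletion L)) : Matrix (Fin (n + n)) (Fin (n + n)) (w.1.adicCompletion L)) i j =
      Matrix.fromBlocks
        (((((UnitaryGroup.evalPlace (Fp L) L (IsCMField.complexConj L) (n₁ + n₁) (hermD L eA dA hdA dW hdW) v
          (UnitaryGroup.finPart (Fp L) L (IsCMField.complexConj L) (n₁ + n₁) (hermD L eA dA hdA dW hdW) h.1) :
        UnitaryGroup.localPi L (IsCMField.complexConj L) (n₁ + n₁) (hermD L eA dA hdA dW hdW) v) : UnitaryGroup.LocalGLPi L (n₁ + n₁) v) w) : GL (Fin (n₁ + n₁)) (w.1.adicCompletion L)) : Matrix (Fin (n₁ + n₁)) (Fin (n₁ + n₁)) (w.1.adicCompletion L))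
        0 0
        (((((UnitaryGroup.evalPlace (Fp L) L (IsCMField.complexConj L) (n₂ + n₂) (hermD L eB dB hdB dW hdW) v
          (UnitaryGroup.finPart (Fp L) L (IsCMField.complexConj L) (n₂ + n₂) (hermD L eB dB hdB dW hdW) h.2) :
        UnitaryGroup.localPi L (IsCMField.complexConj L) (n₂ + n₂) (hermD L eB dB hdB dW hdW) v) : UnitaryGroup.LocalGLPi L (n₂ + n₂) v) w) : GL (Fin (n₂ + n₂)) (w.1.adicCompletion L)) : Matrix (Fin (n₂ + n₂)) (Fin (n₂ + n₂)) (w.1.adicCompletion L))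
        (idxSplitD eV eA eB i) (idxSplitD eV eA eB j) := by
  -- the entry of `(g_v)_w` is the `w`-evaluation of the finite coordinate of the entry of `g` (definitional, ★ `coe_evalPlace_apply`, ★ `GLn.coe_evalAt_apply`)
  have key : ∀ {k : ℕ} {J : Matrix (Fin k) (Fin k) L} (g : ↥(UnitaryGroup.adelic (Fp L) L (IsCMField.complexConj L) k J)) (a b : Fin k),
      ((((UnitaryGroup.evalPlace (Fp L) L (IsCMField.complexConj L) k J v (UnitaryGroup.finPart (Fp L) L (IsCMField.complexConj L) k J g) :
          UnitaryGroup.localPi L (IsCMField.complexConj L) k J v) : UnitaryGroup.LocalGLPi L k v) w : GL (Fin k) (w.1.adicCompletion L)) : Matrix (Fin k) (Fin k) (w.1.adicCompletion L)) a b =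
        (((g : GL (Fin k) (AdeleRing (𝓞 L) L)) : Matrix (Fin k) (Fin k) (AdeleRing (𝓞 L) L)) a b).2 w.1 :=
    fun _ _ _ => rfl
  rw [key, coe_coe_blkD_apply]
  generalize idxSplitD eV eA eB i = z
  generalize idxSplitD eV eA eB j = z'
  rcases z with a | a <;> rcases z' with b | b
  · rw [Matrix.fromBlocks_apply₁₁, Matrix.fromBlocks_apply₁₁, key]
  · rw [Matrix.fromBlocks_apply₁₂, Matrix.fromBlocks_apply₁₂, Matrix.zero_apply, Matrix.zero_apply]
    rfl
  · rw [Matrix.fromBlocks_apply₂₁, Matrix.fromBlocks_apply₂₁, Matrix.zero_apply, Matrix.zero_apply]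
    rfl
  · rw [Matrix.fromBlocks_apply₂₂, Matrix.fromBlocks_apply₂₂, key]

/-- **`((blkD (h₁,h₂))_v)_w = reindexGL σ⁻¹ (blockDiagGL (((h₁)_v)_w, ((h₂)_v)_w))`** in `GL_{n+n}(L_w)` for every `w ∣ v` — the place components of Kudla's see-saw chart are
the see-saw charts of the place components. [cite: BorelJacquet1979, §4.1] [cite: PlatonovRapinchuk1994, §5.1] [cite: Kudla1994, §2] -/
theorem coe_evalPlace_finPart_blkD (h : HA L eA dA hdA dW hdW × HA L eB dB hdB dW hdW) (v : HeightOneSpectrum (𝓞 (Fp L)))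
    (w : UnitaryGroup.PlacesOver L v) :
    (((UnitaryGroup.evalPlace (Fp L) L (IsCMField.complexConj L) (n + n) (hermD L eV dV hdV dW hdW) v
          (UnitaryGroup.finPart (Fp L) L (IsCMField.complexConj L) (n + n) (hermD L eV dV hdV dW hdW) (blkD L eV eA eB dA hdA dB hdB dV hdV hVA hVB dW hdW h)) :
        UnitaryGroup.localPi L (IsCMField.complexConj L) (n + n) (hermD L eV dV hdV dW hdW) v) : UnitaryGroup.LocalGLPi L (n + n) v) w) =
      UnitaryGroup.reindexGL (idxSplitD eV eA eB).symm
        (UnitaryGroup.blockDiagGL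
          ((((UnitaryGroup.evalPlace (Fp L) L (IsCMField.complexConj L) (n₁ + n₁) (hermD L eA dA hdA dW hdW) v
          (UnitaryGroup.finPart (Fp L) L (IsCMField.complexConj L) (n₁ + n₁) (hermD L eA dA hdA dW hdW) h.1) :
        UnitaryGroup.localPi L (IsCMField.complexConj L) (n₁ + n₁) (hermD L eA dA hdA dW hdW) v) : UnitaryGroup.LocalGLPi L (n₁ + n₁) v) w),
            (((UnitaryGroup.evalPlace (Fp L) L (IsCMField.complexConj L) (n₂ + n₂) (hermD L eB dB hdB dW hdW) v
          (UnitaryGroup.finPart (Fp L) L (IsCMField.complexConj L) (n₂ + n₂) (hermD L eB dB hdB dW hdW) h.2) :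
        UnitaryGroup.localPi L (IsCMField.complexConj L) (n₂ + n₂) (hermD L eB dB hdB dW hdW) v) : UnitaryGroup.LocalGLPi L (n₂ + n₂) v) w))) := by
  refine Units.ext (Matrix.ext fun i j => ?_)
  rw [coe_evalPlace_finPart_blkD_apply, UnitaryGroup.coe_reindexGL, UnitaryGroup.coe_blockDiagGL, Matrix.reindex_apply, Matrix.submatrix_apply,
    Equiv.symm_symm]

/-! ## §3 The corner specialisations `blkD (1, y)` and `blkD (x, 1)` -/

/-- **the translated corner family's chart, place by place**: `((blkD (1, y))_v)_w = reindexGL σ⁻¹ (blockDiagGL (1, ((y)_v)_w))` (`(1)_v = 1`). This is the local corner chart the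
factorizability transport (e3) evaluates `Λ_{s,v}` on. [cite: Kudla1994, §2] [cite: BorelJacquet1979, §4.1] -/
theorem coe_evalPlace_finPart_blkD_inr (y : HA L eB dB hdB dW hdW) (v : HeightOneSpectrum (𝓞 (Fp L))) (w : UnitaryGroup.PlacesOver L v) :
    (((UnitaryGroup.evalPlace (Fp L) L (IsCMField.complexConj L) (n + n) (hermD L eV dV hdV dW hdW) v
          (UnitaryGroup.finPart (Fp L) L (IsCMField.complexConj L) (n + n) (hermD L eV dV hdV dW hdW) (blkD L eV eA eB dA hdA dB hdB dV hdV hVA hVB dW hdW (1, y))) :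
        UnitaryGroup.localPi L (IsCMField.complexConj L) (n + n) (hermD L eV dV hdV dW hdW) v) : UnitaryGroup.LocalGLPi L (n + n) v) w) =
      UnitaryGroup.reindexGL (idxSplitD eV eA eB).symm
        (UnitaryGroup.blockDiagGL
          ((1 : GL (Fin (n₁ + n₁)) (w.1.adicCompletion L)),
            (((UnitaryGroup.evalPlace (Fp L) L (IsCMField.complexConj L) (n₂ + n₂) (hermD L eB dB hdB dW hdW) v
          (UnitaryGroup.finPart (Fp L) L (IsCMField.complexConj L) (n₂ + n₂) (hermD L eB dB hdB dW hdW) y) :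
        UnitaryGroup.localPi L (IsCMField.complexConj L) (n₂ + n₂) (hermD L eB dB hdB dW hdW) v) : UnitaryGroup.LocalGLPi L (n₂ + n₂) v) w))) := by
  have h1 : UnitaryGroup.finPart (Fp L) L (IsCMField.complexConj L) (n₁ + n₁) (hermD L eA dA hdA dW hdW) (1 : HA L eA dA hdA dW hdW) = 1 := map_one _
  have h2 : UnitaryGroup.evalPlace (Fp L) L (IsCMField.complexConj L) (n₁ + n₁) (hermD L eA dA hdA dW hdW) v
      (1 : UnitaryGroup.finAdelic (Fp L) L (IsCMField.complexConj L) (n₁ + n₁) (hermD L eA dA hdA dW hdW)) = 1 := map_one _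
  rw [coe_evalPlace_finPart_blkD L eV eA eB dA hdA dB hdB dV hdV hVA hVB dW hdW (1, y) v w]
  dsimp only
  rw [h1, h2, OneMemClass.coe_one, Pi.one_apply]

/-- the archimedean chart of the translated corner family: `↑(blkD (1, y))_∞ = reindexGL σ⁻¹ (blockDiagGL (1, ↑(y)_∞))`. [cite: Kudla1994, §2] [cite: BorelJacquet1979, §4.1] -/
theorem coe_archPart_blkD_inr (y : HA L eB dB hdB dW hdW) :
    ((UnitaryGroup.archPart (Fp L) L (IsCMField.complexConj L) (n + n) (hermD L eV dV hdV dW hdW) (blkD L eV eA eB dA hdA dB hdB dV hdV hVA hVB dW hdW (1, y)) :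
        UnitaryGroup.arch (Fp L) L (IsCMField.complexConj L) (n + n) (hermD L eV dV hdV dW hdW)) : GL (Fin (n + n)) (mixedEmbedding.mixedSpace L)) =
      UnitaryGroup.reindexGL (idxSplitD eV eA eB).symm
        (UnitaryGroup.blockDiagGL
          ((1 : GL (Fin (n₁ + n₁)) (mixedEmbedding.mixedSpace L)),
            ((UnitaryGroup.archPart (Fp L) L (IsCMField.complexConj L) (n₂ + n₂) (hermD L eB dB hdB dW hdW) y :
        UnitaryGroup.arch (Fp L) L (IsCMField.complexConj L) (n₂ + n₂) (hermD L eB dB hdB dW hdW)) : GL (Fin (n₂ + n₂)) (mixedEmbedding.mixedSpace L)))) := by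
  have h1 : UnitaryGroup.archPart (Fp L) L (IsCMField.complexConj L) (n₁ + n₁) (hermD L eA dA hdA dW hdW) (1 : HA L eA dA hdA dW hdW) = 1 := map_one _
  rw [coe_archPart_blkD L eV eA eB dA hdA dB hdB dV hdV hVA hVB dW hdW (1, y)]
  dsimp only
  rw [h1, OneMemClass.coe_one]

/-- the first-summand twin: `((blkD (x, 1))_v)_w = reindexGL σ⁻¹ (blockDiagGL (((x)_v)_w, 1))`. [cite: Kudla1994, §2] [cite: BorelJacquet1979, §4.1] -/
theorem coe_evalPlace_finPart_blkD_inl (x : HA L eA dA hdA dW hdW) (v : HeightOneSpectrum (𝓞 (Fp L))) (w : UnitaryGroup.PlacesOver L v) :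
    (((UnitaryGroup.evalPlace (Fp L) L (IsCMField.complexConj L) (n + n) (hermD L eV dV hdV dW hdW) v
          (UnitaryGroup.finPart (Fp L) L (IsCMField.complexConj L) (n + n) (hermD L eV dV hdV dW hdW) (blkD L eV eA eB dA hdA dB hdB dV hdV hVA hVB dW hdW (x, 1))) :
        UnitaryGroup.localPi L (IsCMField.complexConj L) (n + n) (hermD L eV dV hdV dW hdW) v) : UnitaryGroup.LocalGLPi L (n + n) v) w) =
      UnitaryGroup.reindexGL (idxSplitD eV eA eB).symm
        (UnitaryGroup.blockDiagGL
          ((((UnitaryGroup.evalPlace (Fp L) L (IsCMField.complexConj L) (n₁ + n₁) (hermD L eA dA hdA dW hdW) v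
          (UnitaryGroup.finPart (Fp L) L (IsCMField.complexConj L) (n₁ + n₁) (hermD L eA dA hdA dW hdW) x) :
        UnitaryGroup.localPi L (IsCMField.complexConj L) (n₁ + n₁) (hermD L eA dA hdA dW hdW) v) : UnitaryGroup.LocalGLPi L (n₁ + n₁) v) w),
            (1 : GL (Fin (n₂ + n₂)) (w.1.adicCompletion L)))) := by
  have h1 : UnitaryGroup.finPart (Fp L) L (IsCMField.complexConj L) (n₂ + n₂) (hermD L eB dB hdB dW hdW) (1 : HA L eB dB hdB dW hdW) = 1 := map_one _
  have h2 : UnitaryGroup.evalPlace (Fp L) L (IsCMField.complexConj L) (n₂ + n₂) (hermD L eB dB hdB dW hdW) v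
      (1 : UnitaryGroup.finAdelic (Fp L) L (IsCMField.complexConj L) (n₂ + n₂) (hermD L eB dB hdB dW hdW)) = 1 := map_one _
  rw [coe_evalPlace_finPart_blkD L eV eA eB dA hdA dB hdB dV hdV hVA hVB dW hdW (x, 1) v w]
  dsimp only
  rw [h1, h2, OneMemClass.coe_one, Pi.one_apply]

end Summit.HodgeConjecture.HodgeConjecture.Cruxes.HLiu418.K2LiuBlockDiagPlaces

end
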